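import Mathlib

/-!
# `OrbitDimensionBound` (stmt-ValiantsHypothesis-16133), line `sign_covering`, stub `stub_signLinearise` —
part 1: normalised stabiliser pairs of a Schurian affine matrix are unipotent

Let `B` be an `m × m` matrix of polynomials over `ℂ` and call `B` SCHURIAN (the line's `IsSchurian`) if every
pair `(g, h) ∈ GL_m × GL_m` of FINITE ORDER with `g · B = B · h` is a scalar pair `(c, c)`.  This file proves the
structural consequence used by the linearisation of projective lifts:

* `isNilpotent_of_stabiliser` — if `B` is Schurian, `g · B = B · h` for square matrices `g, h`, and `h` fixes a
  nonzero vector `c` (`h c = c`), then `g - 1` and `h - 1` are nilpotent.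

Proof.  For `λ : ℂ` let `P_g(λ)`, `P_h(λ)` be the projections onto the generalised `λ`-eigenspaces of `g`, `h` along
the other generalised eigenspaces (`ℂ` is algebraically closed, so these span).  Since `g B_d = B_d h` for every
coefficient matrix `B_d` of `B`, `B_d` maps the generalised `μ`-eigenspace of `h` into that of `g`, hence
`P_g(λ) B_d = B_d P_h(λ)`; so `(1 - 2 P_g(λ), 1 - 2 P_h(λ))` is a pair of involutions stabilising `B`, and the Schurian
property makes it a scalar pair: `P_g(λ) = P_h(λ) = t · 1` with `t ∈ {0, 1}` (idempotent).  If `λ ≠ 1` then `t = 1` is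
impossible (`c` lies in the generalised `1`-eigenspace of `h`, on which `P_h(λ)` vanishes), so both generalised
`λ`-eigenspaces are zero; hence the generalised `1`-eigenspaces are everything and `g - 1`, `h - 1` are nilpotent.

No new definitions; helper file for `Theorems/FreeSubtorusOrbitDimensionBoundStubSignLinearise.lean`
(`--supports stmt-ValiantsHypothesis-16133`).  Nothing here moves the crux `OrbitDimensionBound`, the route
`FreeSubtorus` or VP ≠ VNP.

## References
* [LandsbergRessayre2017] J. M. Landsberg, N. Ressayre, *Permanent v. determinant: an exponential lower bound
  assuming symmetry and a potential path towards Valiant's conjecture*, Differential Geom. Appl. 55 (2017), §6.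
* J. von zur Gathen, *Permanent and determinant*, Linear Algebra Appl. 96 (1987), Thm. 3.4 (local endomorphism
  algebras of representations of the permanent).
-/

set_option linter.dupNamespace false

namespace Summit.ValiantsHypothesis.ValiantsHypothesis.Theorems.FreeSubtorusOrbitDimensionBound.SignCovering

open Matrix MvPolynomial Module Module.End

/-! ### §1 Coefficientwise form of `g · B = B · h` -/

section Coeff

variable {σ : Type*} {m : ℕ}

/-- `coeff d (p * C a) = coeff d p * a`. [folklore] -/
theorem coeff_mul_C' (d : σ →₀ ℕ) (p : MvPolynomial σ ℂ) (a : ℂ) : coeff d (p * C a) = coeff d p * a := by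
  rw [mul_comm, coeff_C_mul, mul_comm]

/-- `g·B = B·h` for constant `g, h` holds iff it holds for every coefficient matrix of `B`. [folklore] -/
theorem map_C_mul_eq_mul_map_C_iff (g h : Matrix (Fin m) (Fin m) ℂ)
    (B : Matrix (Fin m) (Fin m) (MvPolynomial σ ℂ)) :
    g.map C * B = B * h.map C ↔ ∀ d : σ →₀ ℕ, g * B.map (coeff d) = B.map (coeff d) * h := by
  constructor
  · intro hgh d
    ext i j
    have hij := congr_fun (congr_fun hgh i) j
    have := congrArg (coeff d) hij
    simpa [Matrix.mul_apply, coeff_sum, coeff_C_mul, coeff_mul_C'] using this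
  · intro hd
    ext i j d
    have hij := congr_fun (congr_fun (hd d) i) j
    simpa [Matrix.mul_apply, coeff_sum, coeff_C_mul, coeff_mul_C'] using hij

end Coeff

/-! ### §2 Projections onto generalised eigenspaces -/

section Proj

variable {V : Type*} [AddCommGroup V] [Module ℂ V] [FiniteDimensional ℂ V]

/-- The projection onto the generalised `λ`-eigenspace along the other generalised eigenspaces (they span, `ℂ`
algebraically closed): a linear map fixing the generalised `λ`-eigenspace, with values in it, and killing every
other generalised eigenspace. [folklore] -/
theorem exists_genEigenProj (f : Module.End ℂ V) (t : ℂ) :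
    ∃ P : Module.End ℂ V, (∀ x, P x ∈ f.maxGenEigenspace t) ∧ (∀ x ∈ f.maxGenEigenspace t, P x = x) ∧
      (∀ μ, μ ≠ t → ∀ x ∈ f.maxGenEigenspace μ, P x = 0) := by
  classical
  set p : Submodule ℂ V := f.maxGenEigenspace t with hp
  set q : Submodule ℂ V := ⨆ (μ : ℂ) (_ : μ ≠ t), f.maxGenEigenspace μ with hq
  have hdis : Disjoint p q := (Module.End.independent_maxGenEigenspace f) t
  have hcod : Codisjoint p q := by
    rw [codisjoint_iff, hp, hq, ← iSup_split_single (fun μ => f.maxGenEigenspace μ) t]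
    exact Module.End.iSup_maxGenEigenspace_eq_top f
  have hpq : IsCompl p q := ⟨hdis, hcod⟩
  refine ⟨p.projection q hpq, fun x => Submodule.projection_apply_mem hpq x,
    fun x hx => Submodule.projection_apply_of_mem_left hpq hx, fun μ hμ x hx => ?_⟩
  refine Submodule.projection_apply_of_mem_right hpq ?_
  rw [hq]
  exact (le_biSup (fun μ => f.maxGenEigenspace μ) hμ) hx

omit [FiniteDimensional ℂ V] in
/-- If `Φ` intertwines `f₂` with `f₁` (`f₁ ∘ Φ = Φ ∘ f₂`), then `Φ` maps the generalised `μ`-eigenspace of `f₂` into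
that of `f₁`. [folklore] -/
theorem map_maxGenEigenspace_le_of_semiconj (f₁ f₂ Φ : Module.End ℂ V) (h : f₁ * Φ = Φ * f₂) (μ : ℂ)
    {x : V} (hx : x ∈ f₂.maxGenEigenspace μ) : Φ x ∈ f₁.maxGenEigenspace μ := by
  rw [Module.End.mem_maxGenEigenspace] at hx ⊢
  obtain ⟨k, hk⟩ := hx
  refine ⟨k, ?_⟩
  have hsc : SemiconjBy Φ (f₂ - μ • (1 : Module.End ℂ V)) (f₁ - μ • (1 : Module.End ℂ V)) := by
    unfold SemiconjBy
    rw [mul_sub, sub_mul, mul_smul_comm, smul_mul_assoc, mul_one, one_mul, h]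
  have hk' := hsc.pow_right k
  have := congrArg (fun T : Module.End ℂ V => T x) hk'.eq
  simp only [Module.End.mul_apply] at this
  rw [← this, hk, map_zero]

/-- A generalised eigenspace which is everything makes `f - μ` nilpotent. [folklore] -/
theorem isNilpotent_sub_smul_one_of_maxGenEigenspace_eq_top (f : Module.End ℂ V) (μ : ℂ)
    (h : f.maxGenEigenspace μ = ⊤) : IsNilpotent (f - μ • (1 : Module.End ℂ V)) := by
  rw [Module.End.maxGenEigenspace_eq_genEigenspace_finrank, Module.End.genEigenspace_nat,
    LinearMap.ker_eq_top] at h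
  exact ⟨finrank ℂ V, h⟩

end Proj

/-! ### §3 Normalised stabiliser pairs of a Schurian matrix are unipotent -/

section Stab

variable {σ : Type*} {m : ℕ}

/-- An involution of `ℂ^m` is an element of `GL_m` of finite order. [folklore] -/
theorem exists_GL_of_mul_self_eq_one (G : Matrix (Fin m) (Fin m) ℂ) (hG : G * G = 1) :
    ∃ u : GL (Fin m) ℂ, (u : Matrix (Fin m) (Fin m) ℂ) = G ∧ IsOfFinOrder u := by
  refine ⟨⟨G, G, hG, hG⟩, rfl, isOfFinOrder_iff_pow_eq_one.2 ⟨2, by norm_num, ?_⟩⟩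
  ext1
  rw [Units.val_pow_eq_pow_val, pow_two, Units.val_one]
  exact hG

/-- **Normalised stabiliser pairs of a Schurian matrix are unipotent.**  If every finite-order pair `(g, h)` of
invertible matrices with `g · B = B · h` is scalar, then any square `g, h` with `g · B = B · h` such that `h` fixes a
nonzero vector have `g - 1` and `h - 1` nilpotent. [folklore] -/
theorem isNilpotent_of_stabiliser (B : Matrix (Fin m) (Fin m) (MvPolynomial σ ℂ))
    (hS : ∀ g h : GL (Fin m) ℂ,
      (g : Matrix (Fin m) (Fin m) ℂ).map C * B = B * (h : Matrix (Fin m) (Fin m) ℂ).map C →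
      IsOfFinOrder g → IsOfFinOrder h →
      ∃ c : ℂ, (g : Matrix (Fin m) (Fin m) ℂ) = c • (1 : Matrix (Fin m) (Fin m) ℂ) ∧
        (h : Matrix (Fin m) (Fin m) ℂ) = c • (1 : Matrix (Fin m) (Fin m) ℂ))
    (g h : Matrix (Fin m) (Fin m) ℂ) (hgh : g.map C * B = B * h.map C)
    (c : Fin m → ℂ) (hc : c ≠ 0) (hhc : h *ᵥ c = c) :
    IsNilpotent (g - 1) ∧ IsNilpotent (h - 1) := by
  classical
  -- the endomorphisms
  set Tg : Module.End ℂ (Fin m → ℂ) := Matrix.toLin' g with hTg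
  set Th : Module.End ℂ (Fin m → ℂ) := Matrix.toLin' h with hTh
  set Φ : (σ →₀ ℕ) → Module.End ℂ (Fin m → ℂ) := fun d => Matrix.toLin' (B.map (coeff d)) with hΦ
  have hcoef := (map_C_mul_eq_mul_map_C_iff g h B).1 hgh
  have hint : ∀ d, Tg * Φ d = Φ d * Th := by
    intro d
    simp only [hTg, hTh, hΦ, Module.End.mul_eq_comp, ← Matrix.toLin'_mul, hcoef d]
  -- `c` lies in the generalised `1`-eigenspace of `Th`
  have hc1 : c ∈ Th.maxGenEigenspace 1 := by
    rw [Module.End.mem_maxGenEigenspace]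
    refine ⟨1, ?_⟩
    simp [hTh, Matrix.toLin'_apply, hhc]
  -- for `λ ≠ 1` both generalised `λ`-eigenspaces vanish
  have key : ∀ t : ℂ, t ≠ 1 → Tg.maxGenEigenspace t = ⊥ ∧ Th.maxGenEigenspace t = ⊥ := by
    intro t ht
    obtain ⟨Pg, hPg1, hPg2, hPg3⟩ := exists_genEigenProj Tg t
    obtain ⟨Ph, hPh1, hPh2, hPh3⟩ := exists_genEigenProj Th t
    -- the projections intertwine
    have hPint : ∀ d, Pg * Φ d = Φ d * Ph := by
      intro d
      refine LinearMap.ext fun x => ?_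
      have hx : x ∈ ⨆ μ : ℂ, Th.maxGenEigenspace μ := by
        rw [Module.End.iSup_maxGenEigenspace_eq_top]; exact Submodule.mem_top
      refine Submodule.iSup_induction (fun μ : ℂ => Th.maxGenEigenspace μ)
        (motive := fun x => (Pg * Φ d) x = (Φ d * Ph) x) hx ?_ (by simp) ?_
      · intro μ x hxμ
        have hΦx : Φ d x ∈ Tg.maxGenEigenspace μ := map_maxGenEigenspace_le_of_semiconj _ _ _ (hint d) μ hxμ
        by_cases hμ : μ = t
        · subst hμ
          rw [Module.End.mul_apply, Module.End.mul_apply, hPg2 _ hΦx, hPh2 _ hxμ]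
        · rw [Module.End.mul_apply, Module.End.mul_apply, hPg3 μ hμ _ hΦx, hPh3 μ hμ _ hxμ, map_zero]
      · intro x y hx hy
        rw [map_add, map_add, hx, hy]
    -- idempotency
    have hPgP : Pg * Pg = Pg := LinearMap.ext fun x => hPg2 _ (hPg1 x)
    have hPhP : Ph * Ph = Ph := LinearMap.ext fun x => hPh2 _ (hPh1 x)
    -- the involutions `1 - 2P`
    set G : Module.End ℂ (Fin m → ℂ) := 1 - (2 : ℂ) • Pg with hG
    set H : Module.End ℂ (Fin m → ℂ) := 1 - (2 : ℂ) • Ph with hH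
    have invol : ∀ P : Module.End ℂ (Fin m → ℂ), P * P = P → (1 - (2 : ℂ) • P) * (1 - (2 : ℂ) • P) = 1 := by
      intro P hP
      have hsq : ((2 : ℂ) • P) * ((2 : ℂ) • P) = (4 : ℂ) • P := by
        rw [smul_mul_assoc, mul_smul_comm, hP, smul_smul]; norm_num
      simp only [mul_sub, sub_mul, one_mul, mul_one, hsq]
      module
    have hGG : G * G = 1 := invol Pg hPgP
    have hHH : H * H = 1 := invol Ph hPhP
    have hGint : ∀ d, G * Φ d = Φ d * H := by
      intro d
      rw [hG, hH, sub_mul, mul_sub, one_mul, mul_one, smul_mul_assoc, mul_smul_comm, hPint d]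
    -- as matrices
    set Gm : Matrix (Fin m) (Fin m) ℂ := LinearMap.toMatrix' G with hGm
    set Hm : Matrix (Fin m) (Fin m) ℂ := LinearMap.toMatrix' H with hHm
    have hGGm : Gm * Gm = 1 := by rw [hGm, ← LinearMap.toMatrix'_mul, hGG, LinearMap.toMatrix'_one]
    have hHHm : Hm * Hm = 1 := by rw [hHm, ← LinearMap.toMatrix'_mul, hHH, LinearMap.toMatrix'_one]
    have hGHm : Gm.map C * B = B * Hm.map C := by
      rw [map_C_mul_eq_mul_map_C_iff]
      intro d
      have e1 : LinearMap.toMatrix' G * B.map (coeff d) = LinearMap.toMatrix' (G * Φ d) := by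
        rw [LinearMap.toMatrix'_mul, hΦ]
        simp only [LinearMap.toMatrix'_toLin']
      have e2 : B.map (coeff d) * LinearMap.toMatrix' H = LinearMap.toMatrix' (Φ d * H) := by
        rw [LinearMap.toMatrix'_mul, hΦ]
        simp only [LinearMap.toMatrix'_toLin']
      rw [hGm, hHm, e1, e2, hGint d]
    obtain ⟨uG, huG, huGfin⟩ := exists_GL_of_mul_self_eq_one Gm hGGm
    obtain ⟨uH, huH, huHfin⟩ := exists_GL_of_mul_self_eq_one Hm hHHm
    obtain ⟨c0, hc0g, hc0h⟩ := hS uG uH (by rw [huG, huH]; exact hGHm) huGfin huHfin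
    rw [huG] at hc0g
    rw [huH] at hc0h
    -- back to endomorphisms: `P = s • 1` with `s = (1 - c0)/2`
    have toEnd : ∀ (P : Module.End ℂ (Fin m → ℂ)), LinearMap.toMatrix' (1 - (2 : ℂ) • P) = c0 • 1 →
        P = ((1 - c0) / 2) • (1 : Module.End ℂ (Fin m → ℂ)) := by
      intro P hPm
      have h1 : LinearMap.toMatrix' (1 - (2 : ℂ) • P) =
          LinearMap.toMatrix' (c0 • (1 : Module.End ℂ (Fin m → ℂ))) := by
        rw [hPm, map_smul, LinearMap.toMatrix'_one]
      have h2 : 1 - (2 : ℂ) • P = c0 • (1 : Module.End ℂ (Fin m → ℂ)) := LinearMap.toMatrix'.injective h1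
      have h3 : (2 : ℂ) • P = (1 - c0) • (1 : Module.End ℂ (Fin m → ℂ)) := by
        calc (2 : ℂ) • P = 1 - (1 - (2 : ℂ) • P) := by module
          _ = 1 - c0 • (1 : Module.End ℂ (Fin m → ℂ)) := by rw [h2]
          _ = (1 - c0) • (1 : Module.End ℂ (Fin m → ℂ)) := by module
      have h4 : P = (1 / 2 : ℂ) • ((2 : ℂ) • P) := by rw [smul_smul]; norm_num
      rw [h4, h3, smul_smul]
      ring_nf
    have hPgs := toEnd Pg (by rw [← hG]; exact hc0g)
    have hPhs := toEnd Ph (by rw [← hH]; exact hc0h)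
    set s : ℂ := (1 - c0) / 2 with hs
    -- `s` is idempotent
    have hss : s * s = s := by
      have e1 : (s * s - s) • c = 0 := by
        have := congrArg (fun T : Module.End ℂ (Fin m → ℂ) => T c) hPhP
        simp only [Module.End.mul_apply, hPhs, LinearMap.smul_apply, Module.End.one_apply, smul_smul] at this
        rw [_root_.sub_smul, this, sub_self]
      have e2 : s * s - s = 0 := by
        rcases smul_eq_zero.1 e1 with h0 | h0
        · exact h0
        · exact absurd h0 hc
      exact sub_eq_zero.1 e2
    have hs01 : s = 0 ∨ s = 1 := by
      have : s * (s - 1) = 0 := by rw [mul_sub, hss, mul_one, sub_self]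
      rcases mul_eq_zero.1 this with h0 | h0
      · exact Or.inl h0
      · exact Or.inr (sub_eq_zero.1 h0)
    -- `s = 1` is impossible
    have hs0 : s = 0 := by
      rcases hs01 with h0 | h1
      · exact h0
      · exfalso
        have hPhc : Ph c = c := by rw [hPhs, h1, one_smul, Module.End.one_apply]
        have hPhc0 : Ph c = 0 := hPh3 1 (Ne.symm ht) c hc1
        exact hc (by rw [← hPhc, hPhc0])
    have hPg0 : Pg = 0 := by rw [hPgs, hs0, zero_smul]
    have hPh0 : Ph = 0 := by rw [hPhs, hs0, zero_smul]
    constructor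
    · rw [eq_bot_iff]
      intro x hx
      rw [Submodule.mem_bot, ← hPg2 x hx, hPg0, LinearMap.zero_apply]
    · rw [eq_bot_iff]
      intro x hx
      rw [Submodule.mem_bot, ← hPh2 x hx, hPh0, LinearMap.zero_apply]
  -- hence the generalised `1`-eigenspaces are everything
  have top_of : ∀ T : Module.End ℂ (Fin m → ℂ), (∀ t : ℂ, t ≠ 1 → T.maxGenEigenspace t = ⊥) →
      T.maxGenEigenspace 1 = ⊤ := by
    intro T hT
    refine top_le_iff.1 ?_
    rw [← Module.End.iSup_maxGenEigenspace_eq_top T]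
    refine iSup_le fun μ => ?_
    by_cases hμ : μ = 1
    · rw [hμ]
    · rw [hT μ hμ]; exact bot_le
  have hTg1 := top_of Tg fun t ht => (key t ht).1
  have hTh1 := top_of Th fun t ht => (key t ht).2
  -- and `g - 1`, `h - 1` are nilpotent
  have back : ∀ (M : Matrix (Fin m) (Fin m) ℂ),
      Module.End.maxGenEigenspace (Matrix.toLin' M : Module.End ℂ (Fin m → ℂ)) 1 = ⊤ → IsNilpotent (M - 1) := by
    intro M hM
    obtain ⟨k, hk⟩ := isNilpotent_sub_smul_one_of_maxGenEigenspace_eq_top _ 1 hM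
    refine ⟨k, ?_⟩
    have e1 : Matrix.toLin' M - (1 : ℂ) • (1 : Module.End ℂ (Fin m → ℂ)) = Matrix.toLin' (M - 1) := by
      rw [one_smul, map_sub, Matrix.toLin'_one]; rfl
    rw [e1, ← Matrix.toLin'_pow] at hk
    have : Matrix.toLin' ((M - 1) ^ k) = Matrix.toLin' (0 : Matrix (Fin m) (Fin m) ℂ) := by
      rw [hk, map_zero]
    exact Matrix.toLin'.injective this
  exact ⟨back g hTg1, back h hTh1⟩

end Stab

end Summit.ValiantsHypothesis.ValiantsHypothesis.Theorems.FreeSubtorusOrbitDimensionBound.SignCovering
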